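import Summits.QuantumAdvantage.QuantumAdvantage.Theorems.WbwObfuscatedGluedTreesKowVocabulary
import Literature.Computability.Complexity.BPPErrorReduction
import Literature.Computability.Complexity.UniformDerandomizationTester
import Literature.Computability.Complexity.RandomizedProofs

/-!
# `WbwObfuscatedGluedTrees` (stmt-QuantumAdvantage-2340) — line `knowledge-of-walk-split`: the SPLIT

Stub `stub_split` of the line `knowledge-of-walk-split` of the informal crux `WbwObfuscatedGluedTrees`
(route `Summits/QuantumAdvantage/QuantumAdvantage/Theses/WhiteBoxWalk`): for ANY walk model `M` and ANY
generator/answer pair `(gen, ans)`,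

  `Coherent M gen ans → KnowledgeOfWalk M gen → WordHard M gen ans → ClauseC gen ans`.

Proof (union bound + transport of the coin budget).  Fix a PPT `A` and take its deterministic poly-time
extractor `E` from KWA.  The word finder `W := ⟨fun z r => E (boolPair z r), A.coinLen⟩` is PPT: its run
map on the pair presentation `boolPair z r` IS `E` (same machine, same polynomial), and its coin budget is
`A`'s.  Pointwise in the level `n`, the seed `s` and the coin string `r`: if `ans s <+: A.run z r` then
(`Coherent`: `|ans s| = nameLen (gen s)`) the name part of `A`'s output is `ans s`, a valid non-entrance
name; so either the KWA-failure event holds for `r`, or `E`'s word ends at `ans s`, i.e. `W` succeeds on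
`r`.  Hence `Pr[A finds ans] ≤ Pr[KWA fails] + Pr[W finds a word]` (`IWUniform.uniformProb_le_add_of_imp`,
`RandAlg.pr_eq_uniformProb`), the bound averages over the seed, both majorants decay superpolynomially
(KWA, resp. `WordHard` applied to `W`), and so does the nonnegative minorant
(`SuperpolynomialDecay.add`, `.trans_abs_le`).
-/

set_option linter.dupNamespace false

noncomputable section

namespace Summit.QuantumAdvantage.QuantumAdvantage.Theorems.WbwObfuscatedGluedTrees.KnowledgeOfWalk

open Literature.Computability.Cryptography Literature.Computability.Complexity Filter Asymptotics
open Summit.QuantumAdvantage.QuantumAdvantage.Theorems.WbwObfuscatedGluedTrees.Negative (ClauseC)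

namespace Split

/-- The WORD FINDER of the split: run the extractor `E` on `⟨input, coins⟩`, with `A`'s coin budget.
[folklore] -/
def wordFinder (A : RandAlg (List Bool) (List Bool)) (E : List Bool → List ℕ) :
    RandAlg (List Bool) (List ℕ) where
  run z r := E (boolPair z r)
  coinLen := A.coinLen

/-- The word finder is PPT: its run map, read through the pair presentation `boolPair z r`, IS the
poly-time extractor `E`, and its coin budget is the (polynomially bounded) budget of `A`. [folklore] -/
theorem isPPT_wordFinder {A : RandAlg (List Bool) (List Bool)} {E : List Bool → List ℕ}
    (hA : IsPPT A id) (hE : PolyTimeComputable id encodingListNatBool.encode E) :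
    IsPPT (wordFinder A E) encodingListNatBool.encode :=
  ⟨PolyTimeComputable.of_encode_eq (f := E) (fun p : List Bool × List Bool => boolPair p.1 p.2)
    (fun _ => rfl) (fun _ => rfl) hE, hA.2⟩

/-- Monotonicity of the uniform average (termwise on strings of the sampled length). [folklore] -/
theorem uniformAvg_mono {m : ℕ} {f g : List Bool → ℝ} (h : ∀ x : List Bool, x.length = m → f x ≤ g x) :
    uniformAvg m f ≤ uniformAvg m g := by
  unfold uniformAvg
  exact div_le_div_of_nonneg_right (Finset.sum_le_sum fun x _ => h _ (by simp)) (by positivity)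

/-- Union-bound averaging: a termwise bound `a ≤ f + w` averages. [folklore] -/
theorem uniformAvg_le_add {m : ℕ} {a f w : List Bool → ℝ}
    (h : ∀ x : List Bool, x.length = m → a x ≤ f x + w x) :
    uniformAvg m a ≤ uniformAvg m f + uniformAvg m w := by
  have e : uniformAvg m (fun x => f x + w x) = uniformAvg m f + uniformAvg m w := by
    unfold uniformAvg
    rw [Finset.sum_add_distrib, add_div]
  rw [← e]
  exact uniformAvg_mono h

/-- Under `Coherent`, an output with prefix `ans s` has name part `ans s`. [folklore] -/
theorem nameOf_eq_of_prefix {M : WalkModel} {gen ans : List Bool → List Bool} (hC : Coherent M gen ans)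
    (s : List Bool) {y : List Bool} (hy : ans s <+: y) : M.nameOf (gen s) y = ans s := by
  rw [WalkModel.nameOf, ← (hC s).1]
  exact (List.prefix_iff_eq_take.1 hy).symm

/-- **Pointwise union bound.**  For every level `n` and seed `s`, the probability that `A` outputs a string
with prefix `ans s` is at most the KWA-failure probability plus the probability that the word finder's word
ends at `ans s`. [folklore] -/
theorem pr_le_fail_add_word (M : WalkModel) (gen ans : List Bool → List Bool) (hC : Coherent M gen ans)
    (A : RandAlg (List Bool) (List Bool)) (E : List Bool → List ℕ) (n : ℕ) (s : List Bool) :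
    A.pr id (inst gen n s) {y | ans s <+: y} ≤
      uniformProb (A.coinLen (inst gen n s).length)
          {r | M.IsValid (gen s) (M.nameOf (gen s) (A.run (inst gen n s) r)) ∧
               M.nameOf (gen s) (A.run (inst gen n s) r) ≠ M.entrance (gen s) ∧
               M.endpoint (gen s) (E (boolPair (inst gen n s) r)) ≠
                 some (M.nameOf (gen s) (A.run (inst gen n s) r))} +
        (wordFinder A E).pr id (inst gen n s) {w | M.endpoint (gen s) w = some (ans s)} := by
  rw [RandAlg.pr_eq_uniformProb, RandAlg.pr_eq_uniformProb]
  refine IWUniform.uniformProb_le_add_of_imp fun r _ hr => ?_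
  have hname : M.nameOf (gen s) (A.run (inst gen n s) r) = ans s := nameOf_eq_of_prefix hC s hr
  by_cases hend : M.endpoint (gen s) (E (boolPair (inst gen n s) r)) = some (ans s)
  · exact Or.inr hend
  · refine Or.inl ?_
    simp only [Set.mem_setOf_eq, hname]
    exact ⟨(hC s).2.1, (hC s).2.2, hend⟩

end Split

open Split in
/-- **STUB 1 — the SPLIT.**  For any walk model and any generator/answer pair: coherence, the
knowledge-of-walk axiom (deterministic poly-time extraction of an ENTRANCE-walk from the adversary's coins)
and white-box word hardness together give clause (C).  Union bound
`Pr[ans s <+: A] ≤ Pr[KWA fails] + Pr[the extracted word ends at ans s]`, the second term being the success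
probability of the PPT word finder `⟨fun z r => E (boolPair z r), A.coinLen⟩` (coin budget transported from
`A`); average over the seed, add the two superpolynomially decaying majorants, dominate. [folklore] -/
theorem stub_split :
    ∀ (M : WalkModel) (gen ans : List Bool → List Bool),
      Coherent M gen ans → KnowledgeOfWalk M gen → WordHard M gen ans → ClauseC gen ans := by
  intro M gen ans hC hK hW A hA
  obtain ⟨E, hE, hfail⟩ := hK A hA
  have hword := hW (wordFinder A E) (isPPT_wordFinder hA hE)
  refine (hfail.add hword).trans_abs_le fun n => ?_
  have h0 : 0 ≤ uniformAvg n fun s => A.pr id (inst gen n s) {y | ans s <+: y} :=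
    uniformAvg_nonneg fun _ => RandAlg.pr_nonneg _ _ _ _
  have h1 : (uniformAvg n fun s => A.pr id (inst gen n s) {y | ans s <+: y}) ≤
      (uniformAvg n fun s => uniformProb (A.coinLen (inst gen n s).length)
          {r | M.IsValid (gen s) (M.nameOf (gen s) (A.run (inst gen n s) r)) ∧
               M.nameOf (gen s) (A.run (inst gen n s) r) ≠ M.entrance (gen s) ∧
               M.endpoint (gen s) (E (boolPair (inst gen n s) r)) ≠
                 some (M.nameOf (gen s) (A.run (inst gen n s) r))}) +
        uniformAvg n fun s =>
          (wordFinder A E).pr id (inst gen n s) {w | M.endpoint (gen s) w = some (ans s)} :=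
    uniformAvg_le_add fun s _ => pr_le_fail_add_word M gen ans hC A E n s
  change |uniformAvg n fun s => A.pr id (inst gen n s) {y | ans s <+: y}| ≤ _
  rw [abs_of_nonneg h0]
  exact h1.trans (le_abs_self _)

end Summit.QuantumAdvantage.QuantumAdvantage.Theorems.WbwObfuscatedGluedTrees.KnowledgeOfWalk
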